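import Literature.Probability.Percolation.TwoSetExchange
import Mathlib.Tactic.Linarith
import HarnessLib

/-!
# `NoHeavyLowerTail` (stmt-CriticalPhenomena-4575) — the four-point disjoint-attachment row of the apex-pair programme:
# given `{x, b} ↮ {y, c}`, the events `{x ↔ b}` and `{y ↔ c}` are negatively correlated

Support file (prover seat `prim-ineq-gen-8`, gen 31; `--supports stmt-CriticalPhenomena-4575`; memo
`run/shared/lean/prim/prim-ineq-gen-8/FINDING-gen31-APL-PROFILE.md` §2).  No definitions, no named facts, no sorries.

CONTEXT.  The open core of the lineage is the reverse-Harris apex-pair row APL-G / APL(2/3) (files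
`…APLGeometricClosure.lean`, `…APLSwitching.lean`, `…APLSealSwitching.lean`).  Gen 30 reduced APL-G for all finite weighted
graphs to a four-point closure statement (★) for an apex of degree two and found ABSTRACT violators of (★) consistent with every
correlation inequality it imposed (Harris; van den Berg–Häggström–Kahn 2006 Thms. 1.3–1.5 for vertex PAIRS; van den Berg–Kahn 2001;
Gladkov 2024; Gladkov–Zimin 2024 kernel rows).  Gen 31 (memo §2): every such violator breaks the SET form of the BHK theorem —
[VandenbergHaggstromKahn2005, Thm. 2.1 (p. 9) at `q = 1`: "Let `S` and `T` be disjoint sets of vertices, and `f` and `g` bounded,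
measurable functions of `(C_S, C_T)`, each increasing in `C_S` and decreasing in `C_T`. Then on `{S ↛ T}`, `E f g ≥ E f E g`"] —
with `S = {x, b}`, `T = {y, c}`, `f = 1{x ↔ b}`, `g = 1{y ↮ c}`; the worst violator by a factor `9.37`.  That set form is PROVED in
the tree (`Literature.Probability.Percolation.setTwoClusterExchange`, from `BHK2006_twoSetConditionalAssociation`).  This file records
the instance used by the closure searches, in the event vocabulary of the apex files:

* `APL.fourPoint_setSep_negCorrelation` — with `Q = {x,b} ↮ {y,c}` (no open path from `x` or `b` to `y` or `c`),
  **`μ(Q) · μ(Q ∩ {x↔b} ∩ {y↔c}) ≤ μ(Q ∩ {x↔b}) · μ(Q ∩ {y↔c})`**;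
* `APL.fourPoint_setSep_negCorrelation'` — the same with `Q` written as `{x↮y} ∩ {x↮c} ∩ {b↮y} ∩ {b↮c}`;
* `APL.fourPoint_disjointAttachment_row` — the four-atom ("odds-ratio") form
  **`μ(x|y|b|c) · μ(xb|yc) ≤ μ(xb|y|c) · μ(yc|x|b)`**, the atoms being `Q ∩ {x↮b} ∩ {y↮c}`, `Q ∩ {x↔b} ∩ {y↔c}`,
  `Q ∩ {x↔b} ∩ {y↮c}`, `Q ∩ {x↮b} ∩ {y↔c}` (the partitions `x|y|b|c`, `xb|yc`, `xb|y|c`, `yc|x|b` of the four points).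
On `K₄` (no internal vertex) the last row is an identity; on the `L = 1` path laws of the cycle lemma it is an identity given `b ↮ c`
(memo §1–§2).  [this work]
-/

noncomputable section

open MeasureTheory Set
open Literature.Probability.LatticeModels (prodBernoulli)
open Literature.Probability.Percolation Literature.Probability.Percolation.TwoSetExchange

namespace Summit.CriticalPhenomena.PercolationContinuityZ3.Theorems

namespace APL

variable {V : Type*} [Fintype V]

/-- **BHK 2006 Thm. 2.1 (sets), the instance `S = {x,b}`, `T = {y,c}`, `f = 1{x↔b}`, `g = 1{y↮c}`:**
with `Q = {ω | ∀ s ∈ {x,b}, ∀ t ∈ {y,c}, s ↮ t}`,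
`μ(Q) · μ(Q ∩ ({x↔b} ∩ {y↔c})) ≤ μ(Q ∩ {x↔b}) · μ(Q ∩ {y↔c})` (`Cov(1{x↔b}, 1{y↔c} | Q) ≤ 0`).
Proof: `setTwoClusterExchange` with `A₁ = B₁ = univ`, `A₂ = {x↔b}` (closed under enlarging `C_S`), `B₂ = {y↔c}` (closed under
enlarging `C_T`). [cite: VandenbergHaggstromKahn2005, Thm. 2.1 (p. 9) at q = 1 — corollary, derived in this file] -/
theorem fourPoint_setSep_negCorrelation (w : Sym2 V → unitInterval) (x b y c : V) :
    (prodBernoulli w).real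
        {ω : BondConfig V | ∀ s ∈ ({x, b} : Set V), ∀ t ∈ ({y, c} : Set V), ¬ (openGraph ω).Reachable s t} *
      (prodBernoulli w).real
        ({ω : BondConfig V | ∀ s ∈ ({x, b} : Set V), ∀ t ∈ ({y, c} : Set V), ¬ (openGraph ω).Reachable s t} ∩
          ((openConn x b : Set (BondConfig V)) ∩ openConn y c)) ≤
    (prodBernoulli w).real
        ({ω : BondConfig V | ∀ s ∈ ({x, b} : Set V), ∀ t ∈ ({y, c} : Set V), ¬ (openGraph ω).Reachable s t} ∩
          (openConn x b : Set (BondConfig V))) *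
      (prodBernoulli w).real
        ({ω : BondConfig V | ∀ s ∈ ({x, b} : Set V), ∀ t ∈ ({y, c} : Set V), ¬ (openGraph ω).Reachable s t} ∩
          (openConn y c : Set (BondConfig V))) := by
  have hx : x ∈ ({x, b} : Set V) := mem_insert x {b}
  have hy : y ∈ ({y, c} : Set V) := mem_insert y {c}
  have key := setTwoClusterExchange w ({x, b} : Set V) ({y, c} : Set V)
    (A₁ := (univ : Set (BondConfig V))) (A₂ := (openConn x b : Set (BondConfig V)))
    (B₁ := (univ : Set (BondConfig V))) (B₂ := (openConn y c : Set (BondConfig V)))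
    (fun _ _ _ _ _ => mem_univ _)
    (fun _ _ hs ht h => typePlus_openConn_of_mem ({x, b} : Set V) ({y, c} : Set V) hx b hs ht h)
    (fun _ _ _ _ _ => mem_univ _)
    (fun _ _ hs ht h => typeMinus_openConn_of_mem ({x, b} : Set V) ({y, c} : Set V) hy c hs ht h)
  simpa only [univ_inter, inter_univ] using key

omit [Fintype V] in
/-- The separation event `{{x,b} ↮ {y,c}}` written with `openConn`:
`{x↮y} ∩ {x↮c} ∩ {b↮y} ∩ {b↮c}`. [folklore] -/
theorem setOf_pair_notReachable_pair_eq (x b y c : V) :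
    {ω : BondConfig V | ∀ s ∈ ({x, b} : Set V), ∀ t ∈ ({y, c} : Set V), ¬ (openGraph ω).Reachable s t} =
      ((openConn x y)ᶜ ∩ (openConn x c)ᶜ ∩ (openConn b y)ᶜ ∩ (openConn b c)ᶜ : Set (BondConfig V)) := by
  ext ω
  simp only [mem_setOf_eq, mem_insert_iff, mem_singleton_iff, forall_eq_or_imp, forall_eq, mem_inter_iff,
    mem_compl_iff, openConn]
  tauto

/-- `fourPoint_setSep_negCorrelation` with the guard spelled out: for `Q = {x↮y} ∩ {x↮c} ∩ {b↮y} ∩ {b↮c}`,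
`μ(Q) · μ(Q ∩ {x↔b} ∩ {y↔c}) ≤ μ(Q ∩ {x↔b}) · μ(Q ∩ {y↔c})`.
[cite: VandenbergHaggstromKahn2005, Thm. 2.1 (p. 9) at q = 1 — corollary, derived in this file] -/
theorem fourPoint_setSep_negCorrelation' (w : Sym2 V → unitInterval) (x b y c : V) :
    (prodBernoulli w).real ((openConn x y)ᶜ ∩ (openConn x c)ᶜ ∩ (openConn b y)ᶜ ∩ (openConn b c)ᶜ : Set (BondConfig V)) *
      (prodBernoulli w).real (((openConn x y)ᶜ ∩ (openConn x c)ᶜ ∩ (openConn b y)ᶜ ∩ (openConn b c)ᶜ) ∩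
          ((openConn x b : Set (BondConfig V)) ∩ openConn y c)) ≤
    (prodBernoulli w).real (((openConn x y)ᶜ ∩ (openConn x c)ᶜ ∩ (openConn b y)ᶜ ∩ (openConn b c)ᶜ) ∩
          (openConn x b : Set (BondConfig V))) *
      (prodBernoulli w).real (((openConn x y)ᶜ ∩ (openConn x c)ᶜ ∩ (openConn b y)ᶜ ∩ (openConn b c)ᶜ) ∩
          (openConn y c : Set (BondConfig V))) := by
  have key := fourPoint_setSep_negCorrelation w x b y c
  rw [setOf_pair_notReachable_pair_eq] at key
  exact key

/-- **The four-atom (odds-ratio) form**: with `Q = {x↮y} ∩ {x↮c} ∩ {b↮y} ∩ {b↮c}` and the four atoms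
`x|y|b|c = Q ∩ {x↮b} ∩ {y↮c}`, `xb|yc = Q ∩ {x↔b} ∩ {y↔c}`, `xb|y|c = Q ∩ {x↔b} ∩ {y↮c}`, `yc|x|b = Q ∩ {x↮b} ∩ {y↔c}`:
**`μ(x|y|b|c) · μ(xb|yc) ≤ μ(xb|y|c) · μ(yc|x|b)`**.  (Expand `μ(Q) = Σ` of the four atoms and `μ(Q ∩ {x↔b})`,
`μ(Q ∩ {y↔c})` as sums of two atoms in `fourPoint_setSep_negCorrelation'`; the cross terms cancel.)  This is the row that
cuts the abstract four-point violators of gen 30 (memo §2). [this work] -/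
theorem fourPoint_disjointAttachment_row (w : Sym2 V → unitInterval) (x b y c : V) :
    (prodBernoulli w).real (((openConn x y)ᶜ ∩ (openConn x c)ᶜ ∩ (openConn b y)ᶜ ∩ (openConn b c)ᶜ) ∩
          ((openConn x b)ᶜ ∩ (openConn y c)ᶜ) : Set (BondConfig V)) *
      (prodBernoulli w).real (((openConn x y)ᶜ ∩ (openConn x c)ᶜ ∩ (openConn b y)ᶜ ∩ (openConn b c)ᶜ) ∩
          (openConn x b ∩ openConn y c) : Set (BondConfig V)) ≤
    (prodBernoulli w).real (((openConn x y)ᶜ ∩ (openConn x c)ᶜ ∩ (openConn b y)ᶜ ∩ (openConn b c)ᶜ) ∩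
          (openConn x b ∩ (openConn y c)ᶜ) : Set (BondConfig V)) *
      (prodBernoulli w).real (((openConn x y)ᶜ ∩ (openConn x c)ᶜ ∩ (openConn b y)ᶜ ∩ (openConn b c)ᶜ) ∩
          ((openConn x b)ᶜ ∩ openConn y c) : Set (BondConfig V)) := by
  classical
  set μ := prodBernoulli w with hμ
  set Q : Set (BondConfig V) :=
    ((openConn x y)ᶜ ∩ (openConn x c)ᶜ ∩ (openConn b y)ᶜ ∩ (openConn b c)ᶜ : Set (BondConfig V)) with hQ
  set A : Set (BondConfig V) := (openConn x b : Set (BondConfig V)) with hA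
  set B : Set (BondConfig V) := (openConn y c : Set (BondConfig V)) with hB
  have hmA : MeasurableSet A := MeasurableSet.of_discrete
  have hmB : MeasurableSet B := MeasurableSet.of_discrete
  have hmQA : MeasurableSet (Q ∩ A) := MeasurableSet.of_discrete
  -- the four atoms
  set n00 := μ.real (Q ∩ (Aᶜ ∩ Bᶜ)) with hn00
  set n11 := μ.real (Q ∩ (A ∩ B)) with hn11
  set n10 := μ.real (Q ∩ (A ∩ Bᶜ)) with hn10
  set n01 := μ.real (Q ∩ (Aᶜ ∩ B)) with hn01
  -- splitting `μ(Q ∩ A)`, `μ(Q ∩ B)`, `μ(Q)`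
  have hQA : μ.real (Q ∩ A) = n11 + n10 := by
    rw [hn11, hn10, ← measureReal_inter_add_sdiff (s := Q ∩ A) hmB]
    congr 1
    · congr 1; ext ω; simp only [mem_inter_iff]; tauto
    · congr 1; ext ω; simp only [mem_inter_iff, mem_sdiff, mem_compl_iff]; tauto
  have hQB : μ.real (Q ∩ B) = n11 + n01 := by
    rw [hn11, hn01, ← measureReal_inter_add_sdiff (s := Q ∩ B) hmA]
    congr 1
    · congr 1; ext ω; simp only [mem_inter_iff]; tauto
    · congr 1; ext ω; simp only [mem_inter_iff, mem_sdiff, mem_compl_iff]; tauto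
  have hQAc : μ.real (Q ∩ Aᶜ) = n01 + n00 := by
    rw [hn01, hn00, ← measureReal_inter_add_sdiff (s := Q ∩ Aᶜ) hmB]
    congr 1
    · congr 1; ext ω; simp only [mem_inter_iff, mem_compl_iff]; tauto
    · congr 1; ext ω; simp only [mem_inter_iff, mem_sdiff, mem_compl_iff]; tauto
  have hQsplit : μ.real Q = (n11 + n10) + (n01 + n00) := by
    rw [← hQA, ← hQAc, ← measureReal_inter_add_sdiff (s := Q) hmA]
    rfl
  have key := fourPoint_setSep_negCorrelation' w x b y c
  rw [← hμ, ← hQ, ← hA, ← hB] at key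
  change μ.real Q * μ.real (Q ∩ (A ∩ B)) ≤ μ.real (Q ∩ A) * μ.real (Q ∩ B) at key
  rw [hQsplit, hQA, hQB, ← hn11] at key
  have h00 : 0 ≤ n00 := measureReal_nonneg
  have h11 : 0 ≤ n11 := measureReal_nonneg
  change n00 * n11 ≤ n10 * n01
  nlinarith [key, h00, h11]

end APL

end Summit.CriticalPhenomena.PercolationContinuityZ3.Theorems

end
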